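import Summits.QuantumFields.QCD.Theses.HeatSlicedQuarks
import Summits.QuantumFields.QCD.Theorems.NestedDissectionSeaKineticEdgeDiamagnetic

/-!
# Support for stub `stub_domination` of line `Sketch` (idea `drop-the-wilson-square`)
(crux `Summit.QuantumFields.QCD.Theses.HeatSlicedQuarks.ActionBoundsLowModes`, item stmt-QuantumFields-8872,
route route-QuantumFields-HeatSlicedQuarks)

Elementary lemmas for the Kato / M-matrix domination of the resolvent of the naive kinetic operator
`Tn(U) = (Σ_μ (F_μ − F_μᴴ)ᴴ(F_μ − F_μᴴ)) ⊗ 1_spin` (`F_μ = linkHop ρ U μ`, the `U`-twisted forward shift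
on site ⊗ colour, unitary for a unitary representation `ρ`) by the free scalar double-step walk.
Everything is finite-dimensional linear algebra over Mathlib and the tree's `OverlapLocality` /
`NestedDissectionSeaKineticEdgeDiamagnetic` helpers; no named facts are used.

* Real side (`dom_free_mulVec_apply`, `dom_maxPrinciple`, `dom_mul_inv_of_maxPrinciple`,
  `dom_le_inv_mulVec_of_maxPrinciple`): an operator acting as
  `(H f)(x) = (8 + ε) f(x) − Σ_μ (f(x + e_μ) + f(x − e_μ))` with `ε > 0` satisfies the maximum
  principle `H f ≥ 0 ⇒ f ≥ 0` (evaluate at a minimum of `f`), hence is invertible with a monotone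
  (entrywise nonnegative) inverse: `H f ≤ h ⇒ f ≤ H⁻¹ h`.
* `A ↦ reindex (A ⊗ 1)` is a `*`-homomorphism (`dom_reindex_*_kronecker_one`), so `F̃_μ = F_μ ⊗ 1`
  is unitary and `Tn(U) = 8·1 − Σ_μ (F̃_μ F̃_μ + F̃_μᴴ F̃_μᴴ)` (`dom_naiveKinetic_eq`); in vector form
  `(8 + ε) u = (Tn + ε) u + Σ_μ (F̃_μ (F̃_μ u) + F̃_μᴴ (F̃_μᴴ u))` (`dom_smul_eq_resolvent_add_hops`).
* Entries of the backward hop `(F̃_μᴴ w)(y,a,α) = Σ_b conj(ρ(U(y−μ̂,μ))_{ba}) w(y−μ̂,b,α)` (the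
  forward one is `KineticEdge.reindex_linkHop_kronecker_one_mulVec`); colour rotations by
  (co-)isometries preserve `Σ_{a,α} |w_{aα}|²` (`dom_site_sq_colour_rotate`,
  `dom_site_sq_colour_rotate_star`, from `KineticEdge.sum_norm_sq_mulVec_of_isometry`).
* Site norms `|w|(y) = √(Σ_{a,α} |w(y,a,α)|²)` are Euclidean norms of the colour ⊗ spin blocks
  (`dom_siteNorm_eq_norm`): triangle inequality, homogeneity, finite sums, components, and
  `|δ_{(x,a,α)}| = δ_x` (`dom_siteNorm_single`).
-/

namespace Summit.QuantumFields.QCD.Cruxes.ActionBoundsLowModes.DropTheWilsonSquare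

open Literature.MathematicalPhysics Literature.MathematicalPhysics.QuantumLattice
  Literature.MathematicalPhysics.QuantumFieldTheory Literature.Probability.LatticeModels
open Matrix
open scoped Kronecker ComplexOrder

/-! ## The real side: maximum principle for the free double-step operator -/

section RealSide

variable {ι : Type*} [Fintype ι] [DecidableEq ι] [AddCommGroup ι]

/-- Row action of the free double-step operator `T₀ + ε`:
`((T₀ + ε) f)(x) = (8 + ε) f(x) − Σ_μ (f(x + e_μ) + f(x − e_μ))`. -/
theorem dom_free_mulVec_apply (e : Fin 4 → ι) (ε : ℝ) (f : ι → ℝ) (x : ι) :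
    ((Matrix.of (fun x y : ι => ∑ μ : Fin 4,
        ((if y = x then (2 : ℝ) else 0) - (if y = x + e μ then 1 else 0) -
          (if y = x - e μ then 1 else 0))) + ε • (1 : Matrix ι ι ℝ)) *ᵥ f) x =
      (8 + ε) * f x - ∑ μ : Fin 4, (f (x + e μ) + f (x - e μ)) := by
  rw [Matrix.add_mulVec, Matrix.smul_mulVec, Matrix.one_mulVec, Pi.add_apply, Pi.smul_apply,
    smul_eq_mul, Matrix.mulVec, dotProduct]
  simp only [Matrix.of_apply, Finset.sum_mul, sub_mul, ite_mul, one_mul, zero_mul]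
  rw [Finset.sum_comm]
  simp only [Finset.sum_sub_distrib, Finset.sum_ite_eq', Finset.mem_univ, if_true]
  rw [Finset.sum_const, Finset.card_univ, Fintype.card_fin, nsmul_eq_mul, Nat.cast_ofNat,
    Finset.sum_add_distrib]
  ring

omit [DecidableEq ι] in
/-- **Maximum principle** for an operator acting as `(H f)(x) = (8 + ε) f(x) − Σ_μ (f(x+e_μ) + f(x−e_μ))`
with `ε > 0`: `H f ≥ 0` pointwise forces `f ≥ 0` pointwise (evaluate at a minimum of `f`). -/
theorem dom_maxPrinciple (H : Matrix ι ι ℝ) (e : Fin 4 → ι) {ε : ℝ} (hε : 0 < ε)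
    (hH : ∀ (f : ι → ℝ) (x : ι), (H *ᵥ f) x = (8 + ε) * f x - ∑ μ : Fin 4, (f (x + e μ) + f (x - e μ)))
    (f : ι → ℝ) (hf : ∀ x, 0 ≤ (H *ᵥ f) x) : ∀ x, 0 ≤ f x := by
  obtain ⟨x₀, hx₀⟩ := Finite.exists_min f
  have h0 := hf x₀
  rw [hH] at h0
  have hsum : ∑ _μ : Fin 4, (f x₀ + f x₀) ≤ ∑ μ : Fin 4, (f (x₀ + e μ) + f (x₀ - e μ)) :=
    Finset.sum_le_sum fun μ _ => add_le_add (hx₀ _) (hx₀ _)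
  rw [Finset.sum_const, Finset.card_univ, Fintype.card_fin, nsmul_eq_mul, Nat.cast_ofNat] at hsum
  have hεf : 0 ≤ ε * f x₀ := by linarith
  have hfx₀ : 0 ≤ f x₀ := le_of_mul_le_mul_left (by simpa using hεf) hε
  exact fun x => hfx₀.trans (hx₀ x)

/-- Such an operator is invertible: `H * H⁻¹ = 1` (the maximum principle makes `f ↦ H f` injective). -/
theorem dom_mul_inv_of_maxPrinciple (H : Matrix ι ι ℝ) (e : Fin 4 → ι) {ε : ℝ} (hε : 0 < ε)
    (hH : ∀ (f : ι → ℝ) (x : ι), (H *ᵥ f) x = (8 + ε) * f x - ∑ μ : Fin 4, (f (x + e μ) + f (x - e μ))) :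
    H * H⁻¹ = 1 := by
  have hinj : Function.Injective H.mulVec := by
    intro f g hfg
    have h1 := dom_maxPrinciple H e hε hH (f - g) fun x => by
      rw [Matrix.mulVec_sub, hfg, sub_self, Pi.zero_apply]
    have h2 := dom_maxPrinciple H e hε hH (g - f) fun x => by
      rw [Matrix.mulVec_sub, hfg, sub_self, Pi.zero_apply]
    funext x
    have a := h1 x
    have b := h2 x
    rw [Pi.sub_apply] at a b
    linarith
  exact Matrix.mul_nonsing_inv H
    ((Matrix.isUnit_iff_isUnit_det H).mp (Matrix.mulVec_injective_iff_isUnit.mp hinj))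

/-- **Monotonicity of the inverse** (the inverse of an M-matrix is entrywise nonnegative): if
`H f ≤ h` pointwise then `f ≤ H⁻¹ h` pointwise. -/
theorem dom_le_inv_mulVec_of_maxPrinciple (H : Matrix ι ι ℝ) (e : Fin 4 → ι) {ε : ℝ} (hε : 0 < ε)
    (hH : ∀ (f : ι → ℝ) (x : ι), (H *ᵥ f) x = (8 + ε) * f x - ∑ μ : Fin 4, (f (x + e μ) + f (x - e μ)))
    (f h : ι → ℝ) (hle : ∀ x, (H *ᵥ f) x ≤ h x) : ∀ x, f x ≤ (H⁻¹ *ᵥ h) x := by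
  have hmul := dom_mul_inv_of_maxPrinciple H e hε hH
  have key := dom_maxPrinciple H e hε hH (H⁻¹ *ᵥ h - f) fun x => by
    rw [Matrix.mulVec_sub, Matrix.mulVec_mulVec, hmul, Matrix.one_mulVec, Pi.sub_apply]
    exact sub_nonneg.mpr (hle x)
  intro x
  have := key x
  rw [Pi.sub_apply] at this
  linarith

/-- **Registered sub-goal `stub_dominationMaxPrinciple` (monotone free resolvent).**  For the free
double-step operator `H₀ = T₀ + ε`, `(T₀ f)(x) = Σ_μ (2 f(x) − f(x + e_μ) − f(x − e_μ))`, on any finite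
abelian group and any `ε > 0`: if `H₀ f ≤ h` pointwise then `f ≤ H₀⁻¹ h` pointwise (maximum principle:
`H₀` is an invertible M-matrix with entrywise nonnegative inverse). -/
theorem stub_dominationMaxPrinciple :
    ∀ {ι : Type} [Fintype ι] [DecidableEq ι] [AddCommGroup ι] (e : Fin 4 → ι) (ε : ℝ), 0 < ε →
      ∀ (f h : ι → ℝ),
        (∀ x, ((Matrix.of (fun x y : ι => ∑ μ : Fin 4, ((if y = x then (2 : ℝ) else 0) -
            (if y = x + e μ then 1 else 0) - (if y = x - e μ then 1 else 0))) +
            ε • (1 : Matrix ι ι ℝ)) *ᵥ f) x ≤ h x) →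
        ∀ x, f x ≤ ((Matrix.of (fun x y : ι => ∑ μ : Fin 4, ((if y = x then (2 : ℝ) else 0) -
            (if y = x + e μ then 1 else 0) - (if y = x - e μ then 1 else 0))) +
            ε • (1 : Matrix ι ι ℝ))⁻¹ *ᵥ h) x := by
  intro ι _ _ _ e ε hε f h hle
  exact dom_le_inv_mulVec_of_maxPrinciple _ e hε (dom_free_mulVec_apply e ε) f h hle

end RealSide

/-! ## `A ↦ reindex (A ⊗ 1)` is a `*`-homomorphism -/

section Kron

variable {m p o : Type*}

/-- `(Σ_k A_k) ⊗ 1 = Σ_k (A_k ⊗ 1)` after reindexing. -/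
theorem dom_reindex_sum_kronecker_one [DecidableEq p] {κ : Type*} (s : Finset κ)
    (A : κ → Matrix m m ℂ) (e : m × p ≃ o) :
    Matrix.reindex e e ((∑ k ∈ s, A k) ⊗ₖ (1 : Matrix p p ℂ)) =
      ∑ k ∈ s, Matrix.reindex e e (A k ⊗ₖ (1 : Matrix p p ℂ)) := by
  ext i j
  simp only [Matrix.reindex_apply, Matrix.submatrix_apply, Matrix.kroneckerMap_apply,
    Matrix.sum_apply, Finset.sum_mul]

/-- `(A − B) ⊗ 1 = A ⊗ 1 − B ⊗ 1` after reindexing. -/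
theorem dom_reindex_sub_kronecker_one [DecidableEq p] (A B : Matrix m m ℂ) (e : m × p ≃ o) :
    Matrix.reindex e e ((A - B) ⊗ₖ (1 : Matrix p p ℂ)) =
      Matrix.reindex e e (A ⊗ₖ (1 : Matrix p p ℂ)) -
        Matrix.reindex e e (B ⊗ₖ (1 : Matrix p p ℂ)) := by
  ext i j
  simp only [Matrix.reindex_apply, Matrix.submatrix_apply, Matrix.kroneckerMap_apply,
    Matrix.sub_apply, sub_mul]

/-- `(A B) ⊗ 1 = (A ⊗ 1)(B ⊗ 1)` after reindexing. -/
theorem dom_reindex_mul_kronecker_one [Fintype m] [Fintype p] [DecidableEq p] [Fintype o]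
    (A B : Matrix m m ℂ) (e : m × p ≃ o) :
    Matrix.reindex e e ((A * B) ⊗ₖ (1 : Matrix p p ℂ)) =
      Matrix.reindex e e (A ⊗ₖ (1 : Matrix p p ℂ)) *
        Matrix.reindex e e (B ⊗ₖ (1 : Matrix p p ℂ)) := by
  rw [Matrix.reindex_apply, Matrix.reindex_apply, Matrix.reindex_apply,
    Matrix.submatrix_mul_equiv, ← Matrix.mul_kronecker_mul, Matrix.one_mul]

/-- `Aᴴ ⊗ 1 = (A ⊗ 1)ᴴ` after reindexing. -/
theorem dom_reindex_conjTranspose_kronecker_one [DecidableEq p] (A : Matrix m m ℂ) (e : m × p ≃ o) :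
    Matrix.reindex e e (Aᴴ ⊗ₖ (1 : Matrix p p ℂ)) =
      (Matrix.reindex e e (A ⊗ₖ (1 : Matrix p p ℂ)))ᴴ := by
  rw [Matrix.reindex_apply, Matrix.reindex_apply, Matrix.conjTranspose_submatrix,
    Matrix.conjTranspose_kronecker, Matrix.conjTranspose_one]

/-- `1 ⊗ 1 = 1` after reindexing. -/
theorem dom_reindex_one_kronecker_one [DecidableEq m] [DecidableEq p] [DecidableEq o]
    (e : m × p ≃ o) :
    Matrix.reindex e e ((1 : Matrix m m ℂ) ⊗ₖ (1 : Matrix p p ℂ)) = 1 := by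
  rw [Matrix.reindex_apply, Matrix.one_kronecker_one, Matrix.submatrix_one_equiv]

end Kron

/-! ## The naive kinetic operator as `8 − (double hops)` -/

section ComplexSide

variable {L N : ℕ} [NeZero L] {G : Type*} [Group G]

/-- The spin-diagonal hopping matrix `F̃_μ = F_μ ⊗ 1` is an isometry: `F̃_μᴴ F̃_μ = 1`. -/
theorem dom_bigHop_conjTranspose_mul_self (ρ : G →* Matrix (Fin N) (Fin N) ℂ)
    (hρ : ∀ g, ρ g ∈ Matrix.unitaryGroup (Fin N) ℂ) (U : GaugeConfig 4 L G) (μ : Fin 4) :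
    (Matrix.reindex (Equiv.prodAssoc _ _ _) (Equiv.prodAssoc _ _ _)
       (linkHop ρ U μ ⊗ₖ (1 : Matrix (Fin 4) (Fin 4) ℂ)))ᴴ *
      Matrix.reindex (Equiv.prodAssoc _ _ _) (Equiv.prodAssoc _ _ _)
        (linkHop ρ U μ ⊗ₖ (1 : Matrix (Fin 4) (Fin 4) ℂ)) = 1 := by
  rw [← dom_reindex_conjTranspose_kronecker_one, ← dom_reindex_mul_kronecker_one,
    conjTranspose_mul_linkHop ρ hρ U μ, dom_reindex_one_kronecker_one]

/-- The spin-diagonal hopping matrix `F̃_μ = F_μ ⊗ 1` is a co-isometry: `F̃_μ F̃_μᴴ = 1`. -/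
theorem dom_bigHop_mul_conjTranspose_self (ρ : G →* Matrix (Fin N) (Fin N) ℂ)
    (hρ : ∀ g, ρ g ∈ Matrix.unitaryGroup (Fin N) ℂ) (U : GaugeConfig 4 L G) (μ : Fin 4) :
    Matrix.reindex (Equiv.prodAssoc _ _ _) (Equiv.prodAssoc _ _ _)
      (linkHop ρ U μ ⊗ₖ (1 : Matrix (Fin 4) (Fin 4) ℂ)) *
      (Matrix.reindex (Equiv.prodAssoc _ _ _) (Equiv.prodAssoc _ _ _)
         (linkHop ρ U μ ⊗ₖ (1 : Matrix (Fin 4) (Fin 4) ℂ)))ᴴ = 1 := by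
  rw [← dom_reindex_conjTranspose_kronecker_one, ← dom_reindex_mul_kronecker_one,
    linkHop_mul_conjTranspose ρ hρ U μ, dom_reindex_one_kronecker_one]

/-- **The naive kinetic operator as `8 − (double hops)`**:
`(Σ_μ (F_μ − F_μᴴ)ᴴ(F_μ − F_μᴴ)) ⊗ 1 = 8·1 − Σ_μ (F̃_μ F̃_μ + F̃_μᴴ F̃_μᴴ)`, `F̃_μ = F_μ ⊗ 1`. -/
theorem dom_naiveKinetic_eq (ρ : G →* Matrix (Fin N) (Fin N) ℂ)
    (hρ : ∀ g, ρ g ∈ Matrix.unitaryGroup (Fin N) ℂ) (U : GaugeConfig 4 L G) :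
    Matrix.reindex (Equiv.prodAssoc (TorusSite 4 L) (Fin N) (Fin 4))
        (Equiv.prodAssoc (TorusSite 4 L) (Fin N) (Fin 4))
        ((∑ μ : Fin 4, (linkHop ρ U μ - (linkHop ρ U μ)ᴴ)ᴴ * (linkHop ρ U μ - (linkHop ρ U μ)ᴴ)) ⊗ₖ
          (1 : Matrix (Fin 4) (Fin 4) ℂ)) =
      (8 : ℂ) • (1 : Matrix _ _ ℂ) -
        ∑ μ : Fin 4,
          (Matrix.reindex (Equiv.prodAssoc _ _ _) (Equiv.prodAssoc _ _ _)
             (linkHop ρ U μ ⊗ₖ (1 : Matrix (Fin 4) (Fin 4) ℂ)) *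
              Matrix.reindex (Equiv.prodAssoc _ _ _) (Equiv.prodAssoc _ _ _)
                (linkHop ρ U μ ⊗ₖ (1 : Matrix (Fin 4) (Fin 4) ℂ)) +
            (Matrix.reindex (Equiv.prodAssoc _ _ _) (Equiv.prodAssoc _ _ _)
               (linkHop ρ U μ ⊗ₖ (1 : Matrix (Fin 4) (Fin 4) ℂ)))ᴴ *
              (Matrix.reindex (Equiv.prodAssoc _ _ _) (Equiv.prodAssoc _ _ _)
                 (linkHop ρ U μ ⊗ₖ (1 : Matrix (Fin 4) (Fin 4) ℂ)))ᴴ) := by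
  rw [dom_reindex_sum_kronecker_one]
  have hμ : ∀ μ : Fin 4,
      Matrix.reindex (Equiv.prodAssoc (TorusSite 4 L) (Fin N) (Fin 4))
          (Equiv.prodAssoc (TorusSite 4 L) (Fin N) (Fin 4))
          (((linkHop ρ U μ - (linkHop ρ U μ)ᴴ)ᴴ * (linkHop ρ U μ - (linkHop ρ U μ)ᴴ)) ⊗ₖ
            (1 : Matrix (Fin 4) (Fin 4) ℂ)) =
        (2 : ℂ) • (1 : Matrix _ _ ℂ) -
          (Matrix.reindex (Equiv.prodAssoc _ _ _) (Equiv.prodAssoc _ _ _)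
             (linkHop ρ U μ ⊗ₖ (1 : Matrix (Fin 4) (Fin 4) ℂ)) *
              Matrix.reindex (Equiv.prodAssoc _ _ _) (Equiv.prodAssoc _ _ _)
                (linkHop ρ U μ ⊗ₖ (1 : Matrix (Fin 4) (Fin 4) ℂ)) +
            (Matrix.reindex (Equiv.prodAssoc _ _ _) (Equiv.prodAssoc _ _ _)
               (linkHop ρ U μ ⊗ₖ (1 : Matrix (Fin 4) (Fin 4) ℂ)))ᴴ *
              (Matrix.reindex (Equiv.prodAssoc _ _ _) (Equiv.prodAssoc _ _ _)
                 (linkHop ρ U μ ⊗ₖ (1 : Matrix (Fin 4) (Fin 4) ℂ)))ᴴ) := by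
    intro μ
    have h1 := dom_bigHop_conjTranspose_mul_self ρ hρ U μ
    have h2 := dom_bigHop_mul_conjTranspose_self ρ hρ U μ
    rw [dom_reindex_mul_kronecker_one, dom_reindex_conjTranspose_kronecker_one,
      dom_reindex_sub_kronecker_one, dom_reindex_conjTranspose_kronecker_one,
      Matrix.conjTranspose_sub, Matrix.conjTranspose_conjTranspose, sub_mul, mul_sub, mul_sub,
      h1, h2, two_smul]
    abel
  simp_rw [hμ]
  rw [Finset.sum_sub_distrib, Finset.sum_const, Finset.card_univ, Fintype.card_fin,
    ← Nat.cast_smul_eq_nsmul ℂ, smul_smul]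
  norm_num

/-- Vector form of `dom_naiveKinetic_eq`: `(8 + ε) u = (Tn + ε) u + Σ_μ (F̃_μ(F̃_μ u) + F̃_μᴴ(F̃_μᴴ u))`. -/
theorem dom_smul_eq_resolvent_add_hops (ρ : G →* Matrix (Fin N) (Fin N) ℂ)
    (hρ : ∀ g, ρ g ∈ Matrix.unitaryGroup (Fin N) ℂ) (U : GaugeConfig 4 L G) (ε : ℝ)
    (u : TorusSite 4 L × Fin N × Fin 4 → ℂ) :
    ((8 : ℂ) + ε) • u =
      (Matrix.reindex (Equiv.prodAssoc (TorusSite 4 L) (Fin N) (Fin 4))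
            (Equiv.prodAssoc (TorusSite 4 L) (Fin N) (Fin 4))
            ((∑ μ : Fin 4, (linkHop ρ U μ - (linkHop ρ U μ)ᴴ)ᴴ * (linkHop ρ U μ - (linkHop ρ U μ)ᴴ)) ⊗ₖ
              (1 : Matrix (Fin 4) (Fin 4) ℂ)) +
          (ε : ℂ) • (1 : Matrix (TorusSite 4 L × Fin N × Fin 4) (TorusSite 4 L × Fin N × Fin 4) ℂ)) *ᵥ u +
        ∑ μ : Fin 4,
          (Matrix.reindex (Equiv.prodAssoc _ _ _) (Equiv.prodAssoc _ _ _)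
             (linkHop ρ U μ ⊗ₖ (1 : Matrix (Fin 4) (Fin 4) ℂ)) *ᵥ
              (Matrix.reindex (Equiv.prodAssoc _ _ _) (Equiv.prodAssoc _ _ _)
                 (linkHop ρ U μ ⊗ₖ (1 : Matrix (Fin 4) (Fin 4) ℂ)) *ᵥ u) +
            (Matrix.reindex (Equiv.prodAssoc _ _ _) (Equiv.prodAssoc _ _ _)
               (linkHop ρ U μ ⊗ₖ (1 : Matrix (Fin 4) (Fin 4) ℂ)))ᴴ *ᵥ
              ((Matrix.reindex (Equiv.prodAssoc _ _ _) (Equiv.prodAssoc _ _ _)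
                  (linkHop ρ U μ ⊗ₖ (1 : Matrix (Fin 4) (Fin 4) ℂ)))ᴴ *ᵥ u)) := by
  rw [dom_naiveKinetic_eq ρ hρ U, Matrix.add_mulVec, Matrix.sub_mulVec, Matrix.smul_mulVec,
    Matrix.smul_mulVec, Matrix.one_mulVec, Matrix.sum_mulVec]
  simp_rw [Matrix.add_mulVec, ← Matrix.mulVec_mulVec]
  rw [add_smul]
  abel

/-- Entries of `(F_μ ⊗ 1)ᴴ w`: `((F_μ ⊗ 1)ᴴ w)(y,a,α) = Σ_b conj(ρ(U(y−μ̂,μ))_{ba}) w(y−μ̂,b,α)`. -/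
theorem dom_bigHop_conjTranspose_mulVec_apply (ρ : G →* Matrix (Fin N) (Fin N) ℂ) (U : GaugeConfig 4 L G)
    (μ : Fin 4) (w : TorusSite 4 L × Fin N × Fin 4 → ℂ) (y : TorusSite 4 L) (a : Fin N) (α : Fin 4) :
    ((Matrix.reindex (Equiv.prodAssoc _ _ _) (Equiv.prodAssoc _ _ _)
        (linkHop ρ U μ ⊗ₖ (1 : Matrix (Fin 4) (Fin 4) ℂ)))ᴴ *ᵥ w) (y, a, α) =
      ∑ b, star (ρ (U (y - Pi.single μ 1, μ)) b a) * w (y - Pi.single μ 1, b, α) := by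
  rw [Matrix.mulVec, dotProduct, Fintype.sum_prod_type,
    Finset.sum_eq_single (y - Pi.single μ 1)]
  · simp only [Fintype.sum_prod_type, Matrix.conjTranspose_apply, Matrix.reindex_apply,
      Matrix.submatrix_apply, Equiv.prodAssoc_symm_apply, Matrix.kroneckerMap_apply, linkHop,
      Matrix.of_apply, eq_shift_iff, if_true, Matrix.one_apply, mul_ite, mul_one, mul_zero,
      star_ite_zero, ite_mul, zero_mul, Finset.sum_ite_eq', Finset.mem_univ]
  · intro z _ hz
    have hz' : ¬ y = QuantumFieldTheory.Site.shift z μ := fun h => hz ((eq_shift_iff y z μ).mp h)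
    simp only [Matrix.conjTranspose_apply, Matrix.reindex_apply,
      Matrix.submatrix_apply, Equiv.prodAssoc_symm_apply, Matrix.kroneckerMap_apply, linkHop,
      Matrix.of_apply, if_neg hz', zero_mul, star_zero, Finset.sum_const_zero]
  · exact fun h => absurd (Finset.mem_univ _) h

/-- A colour rotation by an isometry `G` (`Gᴴ G = 1`) at fixed spin preserves the site norm:
`Σ_{a,α} |Σ_b G_{ab} w_{bα}|² = Σ_{a,α} |w_{aα}|²`. -/
theorem dom_site_sq_colour_rotate {N' : ℕ} (Gm : Matrix (Fin N') (Fin N') ℂ) (hG : Gmᴴ * Gm = 1)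
    (w : Fin N' → Fin 4 → ℂ) :
    ∑ a, ∑ α, ‖∑ b, Gm a b * w b α‖ ^ 2 = ∑ a, ∑ α, ‖w a α‖ ^ 2 := by
  rw [Finset.sum_comm]
  conv_rhs => rw [Finset.sum_comm]
  refine Finset.sum_congr rfl fun α _ => ?_
  exact Summit.QuantumFields.QCD.Theorems.KineticEdge.sum_norm_sq_mulVec_of_isometry Gm hG
    (fun b => w b α)

/-- A colour rotation by the adjoint of a co-isometry `G` (`G Gᴴ = 1`) at fixed spin preserves the
site norm: `Σ_{a,α} |Σ_b conj(G_{ba}) w_{bα}|² = Σ_{a,α} |w_{aα}|²`. -/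
theorem dom_site_sq_colour_rotate_star {N' : ℕ} (Gm : Matrix (Fin N') (Fin N') ℂ)
    (hG : Gm * Gmᴴ = 1) (w : Fin N' → Fin 4 → ℂ) :
    ∑ a, ∑ α, ‖∑ b, star (Gm b a) * w b α‖ ^ 2 = ∑ a, ∑ α, ‖w a α‖ ^ 2 := by
  have h := dom_site_sq_colour_rotate Gmᴴ (by rwa [Matrix.conjTranspose_conjTranspose]) w
  simpa only [Matrix.conjTranspose_apply] using h

end ComplexSide


section SiteNorm

variable {X B C : Type*} [Fintype B] [Fintype C]

/-- The site norm `√(Σ_{a,α} |w(y,a,α)|²)` is the Euclidean norm of the block `w(y,·,·)`. -/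
theorem dom_siteNorm_eq_norm (w : X × B × C → ℂ) (y : X) :
    Real.sqrt (∑ a, ∑ α, ‖w (y, a, α)‖ ^ 2) =
      ‖(WithLp.toLp 2 (fun q : B × C => w (y, q.1, q.2)) : EuclideanSpace ℂ (B × C))‖ := by
  rw [EuclideanSpace.norm_eq, Fintype.sum_prod_type]

/-- Triangle inequality for the site norm. -/
theorem dom_siteNorm_add_le (u v : X × B × C → ℂ) (y : X) :
    Real.sqrt (∑ a, ∑ α, ‖(u + v) (y, a, α)‖ ^ 2) ≤
      Real.sqrt (∑ a, ∑ α, ‖u (y, a, α)‖ ^ 2) + Real.sqrt (∑ a, ∑ α, ‖v (y, a, α)‖ ^ 2) := by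
  rw [dom_siteNorm_eq_norm, dom_siteNorm_eq_norm, dom_siteNorm_eq_norm]
  exact norm_add_le (WithLp.toLp 2 (fun q : B × C => u (y, q.1, q.2)) : EuclideanSpace ℂ (B × C))
    (WithLp.toLp 2 (fun q : B × C => v (y, q.1, q.2)))

/-- Homogeneity of the site norm. -/
theorem dom_siteNorm_smul (c : ℂ) (u : X × B × C → ℂ) (y : X) :
    Real.sqrt (∑ a, ∑ α, ‖(c • u) (y, a, α)‖ ^ 2) =
      ‖c‖ * Real.sqrt (∑ a, ∑ α, ‖u (y, a, α)‖ ^ 2) := by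
  rw [dom_siteNorm_eq_norm, dom_siteNorm_eq_norm, ← norm_smul]
  rfl

/-- A component is bounded by the site norm. -/
theorem dom_apply_le_siteNorm (u : X × B × C → ℂ) (y : X) (a : B) (α : C) :
    ‖u (y, a, α)‖ ≤ Real.sqrt (∑ b, ∑ β, ‖u (y, b, β)‖ ^ 2) := by
  rw [dom_siteNorm_eq_norm]
  exact PiLp.norm_apply_le
    (WithLp.toLp 2 (fun q : B × C => u (y, q.1, q.2)) : EuclideanSpace ℂ (B × C)) (a, α)

/-- Site norm of a finite sum of fields. -/
theorem dom_siteNorm_sum_le {κ : Type*} (s : Finset κ) (u : κ → X × B × C → ℂ) (y : X) :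
    Real.sqrt (∑ a, ∑ α, ‖(∑ k ∈ s, u k) (y, a, α)‖ ^ 2) ≤
      ∑ k ∈ s, Real.sqrt (∑ a, ∑ α, ‖u k (y, a, α)‖ ^ 2) := by
  refine Finset.le_sum_of_subadditive
    (fun w : X × B × C → ℂ => Real.sqrt (∑ a, ∑ α, ‖w (y, a, α)‖ ^ 2)) ?_
    (fun v w => dom_siteNorm_add_le v w y) s u
  simp

/-- Site norm of a basis vector: `|δ_{(x,a,α)}|(y) = δ_{x}(y)`. -/
theorem dom_siteNorm_single [DecidableEq X] [DecidableEq B] [DecidableEq C] (x : X) (a : B) (α : C)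
    (y : X) :
    Real.sqrt (∑ b, ∑ β, ‖(Pi.single (x, a, α) (1 : ℂ) : X × B × C → ℂ) (y, b, β)‖ ^ 2) =
      (Pi.single x (1 : ℝ) : X → ℝ) y := by
  by_cases hy : y = x
  · subst hy
    have h : ∀ b β, ‖(Pi.single (y, a, α) (1 : ℂ) : X × B × C → ℂ) (y, b, β)‖ ^ 2 =
        if b = a then (if β = α then 1 else 0) else 0 := by
      intro b β
      by_cases hb : b = a
      · by_cases hβ : β = α
        · subst hb hβ; simp
        · simp [hb, hβ]
      · simp [hb]
    simp_rw [h, Finset.sum_ite_irrel, Finset.sum_const_zero, Finset.sum_ite_eq', Finset.mem_univ,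
      if_true, Real.sqrt_one, Pi.single_eq_same]
  · have h : ∀ b β, (Pi.single (x, a, α) (1 : ℂ) : X × B × C → ℂ) (y, b, β) = 0 := fun b β =>
      Pi.single_eq_of_ne (by simp [Prod.ext_iff, hy]) _
    simp_rw [h, Pi.single_eq_of_ne hy]
    simp

end SiteNorm

end Summit.QuantumFields.QCD.Cruxes.ActionBoundsLowModes.DropTheWilsonSquare
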